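import Literature.NumberTheory.Automorphic.AdelicVectorHeight
import Mathlib.Analysis.Real.Sqrt
import Mathlib.LinearAlgebra.Matrix.GeneralLinearGroup.Defs
import HarnessLib

/-!
# Heights of adelic vectors under a fixed matrix, and almost-minimal rational vectors
(Godement, *Domaines fondamentaux des groupes arithmétiques*, Sém. Bourbaki 257 (1962/63), §1.1
(iv), (vi); Garrett, *Modern Analysis of Automorphic Forms by Example* (2018), Thm. 2.2.2 and
Claim 3.3.2, PDF pp. 82, 162)

Third file of the height machinery of Minkowski reduction for `GL_n` over a number field `K`
(towards `reductionTheory_gl`, Getz–Hahn (2024), Thm. 2.7.2), continuing `AdelicVectorHeight`.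
Everything is proved:

* `matArchBound K w M = (∑ᵢⱼ |Mᵢⱼ|_w²)^{1/2}`, `matFinBound K v M = maxᵢⱼ |Mᵢⱼ|_v` and
  `matHeightBound K M = ∏_w matArchBound^{mult w} · ∏ᶠ_v max(1, matFinBound)` — a height of a
  matrix `M ∈ M_{ι×κ}(𝔸_K)` controlling its action on row vectors;
* `vecArchNorm_vecMul_le` (Cauchy–Schwarz), `vecHeight_vecMul_le` — **`h(x M) ≤ H(M) · h(x)`**
  (Godement §1.1 (vi): "if `M` is a compact part of `GL(V_A)` there are constants with
  `c' ‖x‖ ≤ ‖m(x)‖ ≤ c'' ‖x‖`"; Garrett, Thm. 2.2.2: `h(x) ≪_C h(x g) ≪_C h(x)`), here for a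
  single matrix, which is all reduction theory needs;
* `one_le_matHeightBound_mul_vecHeight` — for `ξ ∈ Kⁿ ∖ 0` and `g ∈ GL_n(𝔸_K)`,
  `1 ≤ H(g⁻¹) · h(ξ g)`: **the heights `h(ξ g)` of the non-zero vectors of the lattice `Kⁿ g` are
  bounded away from `0`** (the part of Godement §1.1 (iv) / Garrett Cor. 3.3.3 "the infimum is
  attained and positive" that the reduction argument uses);
* `exists_vecHeight_vecMul_le_two_mul` — hence an **almost-minimal vector**: some `ξ₀ ≠ 0` with
  `h(ξ₀ g) ≤ 2 h(ξ g)` for all `ξ ≠ 0` (a substitute for the minimal vector of Godement §1.2 /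
  Garrett Thm. 3.3.1 which avoids the finiteness count of Garrett Claim 3.3.2).

## References

* R. Godement, Sém. Bourbaki 257 (1962/63), §1.1 (iv), (vi) (English translation in
  Borel–Godement–Siegel–Weil (2020), PDF p. 157).
* P. Garrett, *Modern Analysis of Automorphic Forms by Example* (2018), Thm. 2.2.2 (PDF p. 82),
  Claim 3.3.2, Cor. 3.3.3 (PDF pp. 162–163) [Garrett2018].
-/

noncomputable section

open scoped NNReal Matrix
open NumberField IsDedekindDomain

namespace Literature.NumberTheory.Automorphic

section Eval

variable {K : Type} [Field K] [NumberField K]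

/-- The `w`-component of an adele as a ring homomorphism `𝔸_K →+* K_w` (evaluation of the
archimedean part at the infinite place `w`). [folklore] -/
def AdeleRing.fstEval (w : InfinitePlace K) : AdeleRing (𝓞 K) K →+* w.Completion :=
  (Pi.evalRingHom _ w).comp (RingHom.fst (InfiniteAdeleRing K) (FiniteAdeleRing (𝓞 K) K))

/-- `AdeleRing.fstEval w a = a.1 w` (definitional). [folklore] -/
@[simp]
theorem AdeleRing.fstEval_apply (w : InfinitePlace K) (a : AdeleRing (𝓞 K) K) :
    AdeleRing.fstEval w a = a.1 w := rfl

end Eval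

section Defs

variable (K : Type) [Field K] [NumberField K] {ι κ : Type*} [Fintype ι] [Fintype κ]

/-- The Frobenius norm `(∑ᵢⱼ |Mᵢⱼ|_w²)^{1/2}` of the `w`-components of an adelic matrix at an
infinite place `w`. [folklore] -/
def matArchBound (w : InfinitePlace K) (M : Matrix ι κ (AdeleRing (𝓞 K) K)) : ℝ≥0 :=
  NNReal.sqrt (∑ ij : ι × κ, ‖(M ij.1 ij.2).1 w‖₊ ^ 2)

/-- The sup norm `maxᵢⱼ |Mᵢⱼ|_v` of the `v`-components of an adelic matrix at a finite place `v`.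
[folklore] -/
def matFinBound (v : HeightOneSpectrum (𝓞 K)) (M : Matrix ι κ (AdeleRing (𝓞 K) K)) : ℝ≥0 :=
  Finset.univ.sup fun ij : ι × κ => ‖(M ij.1 ij.2).2 v‖₊

/-- The **height bound of an adelic matrix**:
`H(M) = ∏_{w ∣ ∞} matArchBound K w M ^ mult w · ∏ᶠ_v max(1, matFinBound K v M)` (the finite
product is a genuine finite product: the entries of `M` are integral at almost all `v`,
`hasFiniteMulSupport_one_sup_matFinBound`). It controls the heights of the vectors `x M`
(`vecHeight_vecMul_le`; Godement, Sém. Bourbaki 257, §1.1 (vi)). [folklore] -/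
def matHeightBound (M : Matrix ι κ (AdeleRing (𝓞 K) K)) : ℝ≥0 :=
  (∏ w : InfinitePlace K, matArchBound K w M ^ w.mult) * ∏ᶠ v, (1 ⊔ matFinBound K v M)

end Defs

section Bounds

variable {K : Type} [Field K] [NumberField K] {ι κ : Type*} [Fintype ι] [Fintype κ]

/-- The finite bounds of a matrix are `≤ 1` at almost all finite places (each entry is a finite
adele, integral almost everywhere). [folklore] -/
theorem eventually_matFinBound_le_one (M : Matrix ι κ (AdeleRing (𝓞 K) K)) :
    ∀ᶠ v : HeightOneSpectrum (𝓞 K) in Filter.cofinite, matFinBound K v M ≤ 1 := by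
  have h : ∀ᶠ v : HeightOneSpectrum (𝓞 K) in Filter.cofinite, ∀ ij : ι × κ,
      (M ij.1 ij.2).2 v ∈ v.adicCompletionIntegers K :=
    Filter.eventually_all.2 fun ij => (M ij.1 ij.2).2.2
  filter_upwards [h] with v hv
  refine Finset.sup_le fun ij _ => ?_
  rw [← NNReal.coe_le_coe, coe_nnnorm, NNReal.coe_one]
  exact Valued.toNormedField.norm_le_one_iff.2 (hv ij)

/-- `v ↦ max(1, matFinBound K v M)` has finite multiplicative support. [folklore] -/
theorem hasFiniteMulSupport_one_sup_matFinBound (M : Matrix ι κ (AdeleRing (𝓞 K) K)) :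
    (fun v => 1 ⊔ matFinBound K v M).HasFiniteMulSupport := by
  refine (Filter.eventually_cofinite.1 (eventually_matFinBound_le_one M)).subset fun v hv => ?_
  intro hle
  exact hv (sup_eq_left.2 hle)

/-- **Cauchy–Schwarz bound at an infinite place**: `‖x M‖_w ≤ (∑ᵢⱼ |Mᵢⱼ|_w²)^{1/2} ‖x‖_w`.
[folklore] -/
theorem vecArchNorm_vecMul_le (w : InfinitePlace K) (x : ι → AdeleRing (𝓞 K) K)
    (M : Matrix ι κ (AdeleRing (𝓞 K) K)) :
    vecArchNorm K w (x ᵥ* M) ≤ matArchBound K w M * vecArchNorm K w x := by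
  rw [vecArchNorm, vecArchNorm, matArchBound, ← NNReal.sqrt_mul, NNReal.sqrt_le_sqrt]
  -- entrywise Cauchy–Schwarz
  have hj : ∀ j, ‖((x ᵥ* M) j).1 w‖₊ ^ 2 ≤
      (∑ i, ‖(M i j).1 w‖₊ ^ 2) * ∑ i, ‖(x i).1 w‖₊ ^ 2 := by
    intro j
    have hsum : ((x ᵥ* M) j).1 w = ∑ i, (x i).1 w * (M i j).1 w := by
      rw [Matrix.vecMul_apply_eq_sum, ← AdeleRing.fstEval_apply w, map_sum]
      simp only [map_mul, AdeleRing.fstEval_apply]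
    have h1 : ‖((x ᵥ* M) j).1 w‖₊ ≤ ∑ i, ‖(M i j).1 w‖₊ * ‖(x i).1 w‖₊ := by
      rw [hsum]
      refine (nnnorm_sum_le _ _).trans (Finset.sum_le_sum fun i _ => ?_)
      rw [nnnorm_mul, mul_comm]
    have h2 := NNReal.sum_mul_le_sqrt_mul_sqrt Finset.univ (fun i => ‖(M i j).1 w‖₊)
      (fun i => ‖(x i).1 w‖₊)
    calc ‖((x ᵥ* M) j).1 w‖₊ ^ 2
        ≤ (NNReal.sqrt (∑ i, ‖(M i j).1 w‖₊ ^ 2) * NNReal.sqrt (∑ i, ‖(x i).1 w‖₊ ^ 2)) ^ 2 :=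
          pow_le_pow_left' (h1.trans h2) 2
      _ = (∑ i, ‖(M i j).1 w‖₊ ^ 2) * ∑ i, ‖(x i).1 w‖₊ ^ 2 := by
          rw [mul_pow, NNReal.sq_sqrt, NNReal.sq_sqrt]
  calc ∑ j, ‖((x ᵥ* M) j).1 w‖₊ ^ 2
      ≤ ∑ j, (∑ i, ‖(M i j).1 w‖₊ ^ 2) * ∑ i, ‖(x i).1 w‖₊ ^ 2 := Finset.sum_le_sum fun j _ => hj j
    _ = (∑ ij : ι × κ, ‖(M ij.1 ij.2).1 w‖₊ ^ 2) * ∑ i, ‖(x i).1 w‖₊ ^ 2 := by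
        rw [← Finset.sum_mul, Fintype.sum_prod_type, Finset.sum_comm]

/-- The finite local heights under a matrix: `h_v(x M) ≤ max(1, matFinBound K v M) · h_v(x)`.
[folklore] -/
theorem vecFinHeight_vecMul_le_one_sup (v : HeightOneSpectrum (𝓞 K)) (x : ι → AdeleRing (𝓞 K) K)
    (M : Matrix ι κ (AdeleRing (𝓞 K) K)) :
    vecFinHeight K v (x ᵥ* M) ≤ (1 ⊔ matFinBound K v M) * vecFinHeight K v x :=
  (vecFinHeight_vecMul_le v x M).trans (mul_le_mul' le_sup_right le_rfl)

/-- **Heights under a fixed matrix**: `h(x M) ≤ H(M) · h(x)` for vectors `x`, `x M` with finite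
height data (Godement, Sém. Bourbaki 257, §1.1 (vi); Garrett (2018), Thm. 2.2.2:
`h(x g) ≪ h(x)`). [cite: Garrett2018, Thm. 2.2.2 (PDF p. 82)] -/
theorem vecHeight_vecMul_le {x : ι → AdeleRing (𝓞 K) K} {M : Matrix ι κ (AdeleRing (𝓞 K) K)}
    (hx : IsHeightFinite K x) (hxM : IsHeightFinite K (x ᵥ* M)) :
    vecHeight K (x ᵥ* M) ≤ matHeightBound K M * vecHeight K x := by
  rw [vecHeight, vecHeight, matHeightBound]
  have harch : (∏ w : InfinitePlace K, vecArchNorm K w (x ᵥ* M) ^ w.mult) ≤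
      (∏ w : InfinitePlace K, matArchBound K w M ^ w.mult) *
        ∏ w : InfinitePlace K, vecArchNorm K w x ^ w.mult := by
    rw [← Finset.prod_mul_distrib]
    refine Finset.prod_le_prod' fun w _ => ?_
    rw [← mul_pow]
    exact pow_le_pow_left' (vecArchNorm_vecMul_le w x M) _
  have hfin : ∏ᶠ v, vecFinHeight K v (x ᵥ* M) ≤
      (∏ᶠ v, (1 ⊔ matFinBound K v M)) * ∏ᶠ v, vecFinHeight K v x := by
    rw [← finprod_mul_distrib (hasFiniteMulSupport_one_sup_matFinBound M) hx]
    refine finprod_le_finprod' hxM ?_ fun v => vecFinHeight_vecMul_le_one_sup v x M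
    exact ((hasFiniteMulSupport_one_sup_matFinBound M).union hx).subset
      (Function.mulSupport_mul _ _)
  calc (∏ w : InfinitePlace K, vecArchNorm K w (x ᵥ* M) ^ w.mult) * ∏ᶠ v, vecFinHeight K v (x ᵥ* M)
      ≤ ((∏ w : InfinitePlace K, matArchBound K w M ^ w.mult) *
          ∏ w : InfinitePlace K, vecArchNorm K w x ^ w.mult) *
        ((∏ᶠ v, (1 ⊔ matFinBound K v M)) * ∏ᶠ v, vecFinHeight K v x) := mul_le_mul' harch hfin
    _ = (∏ w : InfinitePlace K, matArchBound K w M ^ w.mult) * (∏ᶠ v, (1 ⊔ matFinBound K v M)) *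
        ((∏ w : InfinitePlace K, vecArchNorm K w x ^ w.mult) * ∏ᶠ v, vecFinHeight K v x) := by
        ring

end Bounds

/-! ### The lattice `Kⁿ g`: heights bounded away from zero, almost-minimal vectors -/

section Lattice

variable {K : Type} [Field K] [NumberField K] {ι : Type*} [Fintype ι] [DecidableEq ι]

/-- **The heights of the non-zero vectors of `Kⁿ g` are bounded away from zero**: for `ξ ∈ Kⁿ ∖ 0`
and `g ∈ GL_n(𝔸_K)`, `1 ≤ h(ξ) = h((ξ g) g⁻¹) ≤ H(g⁻¹) · h(ξ g)` (Godement, Sém. Bourbaki 257,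
§1.1 (iv), (vi); Garrett (2018), Cor. 3.3.3: the infimum of `h(x g)` over `x ∈ kʳ ∖ 0` is
positive). [cite: Garrett2018, Cor. 3.3.3 (PDF p. 163)] -/
theorem one_le_matHeightBound_mul_vecHeight {ξ : ι → K} (hξ : ξ ≠ 0)
    (g : GL ι (AdeleRing (𝓞 K) K)) :
    1 ≤ matHeightBound K ((g⁻¹ : GL ι (AdeleRing (𝓞 K) K)) : Matrix ι ι (AdeleRing (𝓞 K) K)) *
      vecHeight K (principalVec K ξ ᵥ* (g : Matrix ι ι (AdeleRing (𝓞 K) K))) := by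
  have h1 := one_le_vecHeight_principalVec (K := K) hξ
  have hx : principalVec K ξ ᵥ* (g : Matrix ι ι (AdeleRing (𝓞 K) K)) ᵥ*
      ((g⁻¹ : GL ι (AdeleRing (𝓞 K) K)) : Matrix ι ι (AdeleRing (𝓞 K) K)) = principalVec K ξ := by
    rw [Matrix.vecMul_vecMul, ← Units.val_mul, mul_inv_cancel, Units.val_one, Matrix.vecMul_one]
  have h2 := vecHeight_vecMul_le (K := K) (isHeightFinite_principalVec_vecMul hξ g)
    (M := ((g⁻¹ : GL ι (AdeleRing (𝓞 K) K)) : Matrix ι ι (AdeleRing (𝓞 K) K)))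
    (by rw [hx]; exact isHeightFinite_principalVec hξ)
  rw [hx] at h2
  exact h1.trans h2

/-- **Almost-minimal vectors exist**: for `g ∈ GL_n(𝔸_K)`, `n ≥ 1`, there is `ξ₀ ∈ Kⁿ ∖ 0` with
`h(ξ₀ g) ≤ 2 h(ξ g)` for every `ξ ∈ Kⁿ ∖ 0` (the heights `h(ξ g)`, `ξ ≠ 0`, have a positive
infimum by `one_le_matHeightBound_mul_vecHeight`, and a value below twice the infimum is
attained). This replaces the minimal vector of Godement, Sém. Bourbaki 257, §1.2 ("there is a
`ξ ≠ 0` such that `‖g(ξ)‖` is minimal") / Garrett (2018), proof of Thm. 3.3.1, in the reduction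
argument. [cite: Garrett2018, Thm. 3.3.1 (proof, PDF p. 163)] -/
theorem exists_vecHeight_vecMul_le_two_mul [Nonempty ι] (g : GL ι (AdeleRing (𝓞 K) K)) :
    ∃ ξ₀ : ι → K, ξ₀ ≠ 0 ∧ ∀ ξ : ι → K, ξ ≠ 0 →
      vecHeight K (principalVec K ξ₀ ᵥ* (g : Matrix ι ι (AdeleRing (𝓞 K) K))) ≤
        2 * vecHeight K (principalVec K ξ ᵥ* (g : Matrix ι ι (AdeleRing (𝓞 K) K))) := by
  set C : ℝ≥0 := matHeightBound K ((g⁻¹ : GL ι (AdeleRing (𝓞 K) K)) : Matrix ι ι (AdeleRing (𝓞 K) K))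
    with hC
  set S : Set ℝ≥0 := Set.range fun ξ : {ξ : ι → K // ξ ≠ 0} =>
    vecHeight K (principalVec K ξ.1 ᵥ* (g : Matrix ι ι (AdeleRing (𝓞 K) K))) with hS
  have hone : (fun _ => (1 : K)) ≠ (0 : ι → K) := by
    intro h
    have := congrFun h (Classical.arbitrary ι)
    exact one_ne_zero this
  have hSne : S.Nonempty := ⟨_, ⟨⟨fun _ => 1, hone⟩, rfl⟩⟩
  -- every element of `S` is `≥ C⁻¹ > 0`
  have hC0 : C ≠ 0 := by
    intro h0
    have h := one_le_matHeightBound_mul_vecHeight (K := K) hone g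
    rw [← hC, h0, zero_mul] at h
    exact not_lt.2 h zero_lt_one
  have hlow : ∀ s ∈ S, C⁻¹ ≤ s := by
    rintro s ⟨ξ, rfl⟩
    have h := one_le_matHeightBound_mul_vecHeight (K := K) ξ.2 g
    rw [← hC] at h
    calc C⁻¹ = C⁻¹ * 1 := (mul_one _).symm
      _ ≤ C⁻¹ * (C * _) := mul_le_mul' le_rfl h
      _ = _ := by rw [← mul_assoc, inv_mul_cancel₀ hC0, one_mul]
  set m : ℝ≥0 := sInf S with hm
  have hmpos : 0 < m := lt_of_lt_of_le (inv_pos.2 (pos_iff_ne_zero.2 hC0)) (le_csInf hSne hlow)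
  have hlt : sInf S < 2 * m := by
    rw [← hm, two_mul]
    exact lt_add_of_pos_right m hmpos
  obtain ⟨s, ⟨ξ₀, rfl⟩, hs⟩ := exists_lt_of_csInf_lt hSne hlt
  refine ⟨ξ₀.1, ξ₀.2, fun ξ hξ => ?_⟩
  have hmle : m ≤ vecHeight K (principalVec K ξ ᵥ* (g : Matrix ι ι (AdeleRing (𝓞 K) K))) :=
    csInf_le (OrderBot.bddBelow S) ⟨⟨ξ, hξ⟩, rfl⟩
  exact hs.le.trans (mul_le_mul' le_rfl hmle)

end Lattice

end Literature.NumberTheory.Automorphic
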